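import Summits.AtomisticToContinuum.Crystallization.Theorems.ShellsToBarlowChart.Negative.HaggWord

/-!
# Combinatorial layering (B1a of `GapTwelveToBarlow`): contact walks in the model (graph distance ≤ 1.7 · Euclidean + 2)

Crux `SquareWellLayerCake.GapTwelveToBarlow` (stmt-AtomisticToContinuum-15807), line `Sketch`,
stub `stub_develop` (H_develop), metric closure step (c).  In the model `barlowStacking 1 √(2/3) s`
(`s` a Hägg word) two points at distance `≤ r` are joined by a walk of unit contacts of length
`ℓ ≤ (17/10) r + 2` (`exists_modelWalk`, anchor).  Construction: CLIMB layer by layer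
(`exists_climb_up/_down`), choosing among the three adjacent-layer contacts so that the lateral
drift `E = (3Δi + ΔL, 3Δj + ΔL)` (`ΔL` = change of the letter offset `haggLabel`) stays in the
seven-point set `{(0,0), ±(1,1), ±(−2,1), ±(1,−2)}` (lateral displacement `≤ 1/√3`), then walk in
the layer (`exists_planeWalk`: the hexagonal norm `(|Δi| + |Δj| + |Δi + Δj|)/2` drops by one per
step of `sixOffsets`).  Length: `|Δk| + h ≤ √(3/2)·r_v + (2/√3)(ρ_h + 1/√3) ≤ 1.6833 r + 2/3`
(`3h² ≤ 4(Δi² + ΔiΔj + Δj²)`, Cauchy–Schwarz).  Walks are coded as `g : ℕ → ℝ³` with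
consecutive entries in the stacking at distance `1`.  Nothing is defined; no named fact is used.
-/

noncomputable section

namespace Summit.AtomisticToContinuum.Crystallization.Theorems.SquareWellLayerCakeGapTwelveToBarlow

open Literature.MathematicalPhysics.StatisticalMechanics
open Summit.AtomisticToContinuum.Crystallization.Theorems.ShellsToBarlowChartNegative (sqrt_two_thirds_sq)

/-- **Upper contacts**: `(k+1, i−P, j−Q)` touches `(k, i, j)` for `(P, Q) ∈ threeOffsets (−s k)`.
[folklore] -/
theorem dist_up_eq_one {s : ℤ → ℤ} (hs : IsHaggSeq s) (k i j : ℤ) {P Q : ℤ}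
    (hPQ : (P, Q) ∈ threeOffsets (-s k)) :
    barlowPos 1 (Real.sqrt (2 / 3)) s (k + 1) (i - P) (j - Q) ∈ barlowStacking 1 (Real.sqrt (2 / 3)) s ∧
    dist (barlowPos 1 (Real.sqrt (2 / 3)) s k i j)
      (barlowPos 1 (Real.sqrt (2 / 3)) s (k + 1) (i - P) (j - Q)) = 1 := by
  refine (touching_iff_exists_linkOffsets hs one_pos sqrt_two_thirds_sq k i j _).2
    ⟨((1 : ℤ), (P, Q)), ?_, rfl⟩
  unfold linkOffsets
  exact Finset.mem_union_left _ (Finset.mem_union_right _ (Finset.mem_image.2 ⟨(P, Q), hPQ, rfl⟩))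

/-- **Lower contacts**: `(k−1, i−P, j−Q)` touches `(k, i, j)` for `(P, Q) ∈ threeOffsets (s (k−1))`.
[folklore] -/
theorem dist_down_eq_one {s : ℤ → ℤ} (hs : IsHaggSeq s) (k i j : ℤ) {P Q : ℤ}
    (hPQ : (P, Q) ∈ threeOffsets (s (k - 1))) :
    barlowPos 1 (Real.sqrt (2 / 3)) s (k + (-1)) (i - P) (j - Q) ∈ barlowStacking 1 (Real.sqrt (2 / 3)) s ∧
    dist (barlowPos 1 (Real.sqrt (2 / 3)) s k i j)
      (barlowPos 1 (Real.sqrt (2 / 3)) s (k + (-1)) (i - P) (j - Q)) = 1 := by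
  refine (touching_iff_exists_linkOffsets hs one_pos sqrt_two_thirds_sq k i j _).2
    ⟨((-1 : ℤ), (P, Q)), ?_, rfl⟩
  unfold linkOffsets
  exact Finset.mem_union_right _ (Finset.mem_image.2 ⟨(P, Q), hPQ, rfl⟩)

/-- **In-layer contacts**: `(k, i−P, j−Q)` touches `(k, i, j)` for `(P, Q) ∈ sixOffsets`.
[folklore] -/
theorem dist_six_eq_one {s : ℤ → ℤ} (hs : IsHaggSeq s) (k i j : ℤ) {P Q : ℤ}
    (hPQ : (P, Q) ∈ sixOffsets) :
    barlowPos 1 (Real.sqrt (2 / 3)) s (k + 0) (i - P) (j - Q) ∈ barlowStacking 1 (Real.sqrt (2 / 3)) s ∧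
    dist (barlowPos 1 (Real.sqrt (2 / 3)) s k i j)
      (barlowPos 1 (Real.sqrt (2 / 3)) s (k + 0) (i - P) (j - Q)) = 1 := by
  refine (touching_iff_exists_linkOffsets hs one_pos sqrt_two_thirds_sq k i j _).2
    ⟨((0 : ℤ), (P, Q)), ?_, rfl⟩
  unfold linkOffsets
  exact Finset.mem_union_left _ (Finset.mem_union_left _ (Finset.mem_image.2 ⟨(P, Q), hPQ, rfl⟩))

/-! ## The climb with drift control -/

/-- **One layer up with drift control**: from drift state `E ∈ S₇` and letter `σ = s k`, an upper contact offset `(P, Q) ∈ threeOffsets (−σ)` keeping the new drift `(E₁ − 3P + σ, E₂ − 3Q + σ)` in `S₇`. [folklore] -/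
theorem climbStep_up {σ E₁ E₂ : ℤ} (hσ : σ = 1 ∨ σ = -1)
    (hE : ((E₁ = 0 ∧ E₂ = 0) ∨ (E₁ = 1 ∧ E₂ = 1) ∨ (E₁ = -1 ∧ E₂ = -1) ∨ (E₁ = -2 ∧ E₂ = 1) ∨ (E₁ = -1 ∧ E₂ = 2) ∨ (E₁ = 1 ∧ E₂ = -2) ∨ (E₁ = 2 ∧ E₂ = -1))) :
    ∃ P Q : ℤ, (P, Q) ∈ threeOffsets (-σ) ∧
      ((E₁ - 3 * P + σ = 0 ∧ E₂ - 3 * Q + σ = 0) ∨ (E₁ - 3 * P + σ = 1 ∧ E₂ - 3 * Q + σ = 1) ∨ (E₁ - 3 * P + σ = -1 ∧ E₂ - 3 * Q + σ = -1) ∨ (E₁ - 3 * P + σ = -2 ∧ E₂ - 3 * Q + σ = 1) ∨ (E₁ - 3 * P + σ = -1 ∧ E₂ - 3 * Q + σ = 2) ∨ (E₁ - 3 * P + σ = 1 ∧ E₂ - 3 * Q + σ = -2) ∨ (E₁ - 3 * P + σ = 2 ∧ E₂ - 3 * Q + σ = -1)) := by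
  rcases hσ with rfl | rfl <;>
  rcases hE with ⟨rfl, rfl⟩ | ⟨rfl, rfl⟩ | ⟨rfl, rfl⟩ | ⟨rfl, rfl⟩ | ⟨rfl, rfl⟩ | ⟨rfl, rfl⟩ | ⟨rfl, rfl⟩
  · exact ⟨0, 0, by decide, by norm_num⟩
  · exact ⟨1, 0, by decide, by norm_num⟩
  · exact ⟨0, 0, by decide, by norm_num⟩
  · exact ⟨0, 0, by decide, by norm_num⟩
  · exact ⟨0, 1, by decide, by norm_num⟩
  · exact ⟨0, 0, by decide, by norm_num⟩
  · exact ⟨1, 0, by decide, by norm_num⟩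
  · exact ⟨0, 0, by decide, by norm_num⟩
  · exact ⟨0, 0, by decide, by norm_num⟩
  · exact ⟨-1, 0, by decide, by norm_num⟩
  · exact ⟨-1, 0, by decide, by norm_num⟩
  · exact ⟨0, 0, by decide, by norm_num⟩
  · exact ⟨0, -1, by decide, by norm_num⟩
  · exact ⟨0, 0, by decide, by norm_num⟩

/-- **One layer down with drift control**: from drift state `E ∈ S₇` and letter `σ = s (k−1)`, a lower contact offset `(P, Q) ∈ threeOffsets σ` keeping the new drift `(E₁ − 3P − σ, E₂ − 3Q − σ)` in `S₇`. [folklore] -/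
theorem climbStep_down {σ E₁ E₂ : ℤ} (hσ : σ = 1 ∨ σ = -1)
    (hE : ((E₁ = 0 ∧ E₂ = 0) ∨ (E₁ = 1 ∧ E₂ = 1) ∨ (E₁ = -1 ∧ E₂ = -1) ∨ (E₁ = -2 ∧ E₂ = 1) ∨ (E₁ = -1 ∧ E₂ = 2) ∨ (E₁ = 1 ∧ E₂ = -2) ∨ (E₁ = 2 ∧ E₂ = -1))) :
    ∃ P Q : ℤ, (P, Q) ∈ threeOffsets (σ) ∧
      ((E₁ - 3 * P - σ = 0 ∧ E₂ - 3 * Q - σ = 0) ∨ (E₁ - 3 * P - σ = 1 ∧ E₂ - 3 * Q - σ = 1) ∨ (E₁ - 3 * P - σ = -1 ∧ E₂ - 3 * Q - σ = -1) ∨ (E₁ - 3 * P - σ = -2 ∧ E₂ - 3 * Q - σ = 1) ∨ (E₁ - 3 * P - σ = -1 ∧ E₂ - 3 * Q - σ = 2) ∨ (E₁ - 3 * P - σ = 1 ∧ E₂ - 3 * Q - σ = -2) ∨ (E₁ - 3 * P - σ = 2 ∧ E₂ - 3 * Q - σ = -1)) := by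
  rcases hσ with rfl | rfl <;>
  rcases hE with ⟨rfl, rfl⟩ | ⟨rfl, rfl⟩ | ⟨rfl, rfl⟩ | ⟨rfl, rfl⟩ | ⟨rfl, rfl⟩ | ⟨rfl, rfl⟩ | ⟨rfl, rfl⟩
  · exact ⟨0, 0, by decide, by norm_num⟩
  · exact ⟨0, 0, by decide, by norm_num⟩
  · exact ⟨-1, 0, by decide, by norm_num⟩
  · exact ⟨-1, 0, by decide, by norm_num⟩
  · exact ⟨0, 0, by decide, by norm_num⟩
  · exact ⟨0, -1, by decide, by norm_num⟩
  · exact ⟨0, 0, by decide, by norm_num⟩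
  · exact ⟨0, 0, by decide, by norm_num⟩
  · exact ⟨1, 0, by decide, by norm_num⟩
  · exact ⟨0, 0, by decide, by norm_num⟩
  · exact ⟨0, 0, by decide, by norm_num⟩
  · exact ⟨0, 1, by decide, by norm_num⟩
  · exact ⟨0, 0, by decide, by norm_num⟩
  · exact ⟨1, 0, by decide, by norm_num⟩


/-- **Climbing `n` layers up with drift control**: from `(k, i, j)` with drift state in `S₇`
(relative to the base column `(k₀, i₀, j₀)`), a contact walk of length `n` to a point of layer
`k + n` with drift state in `S₇`. [folklore] -/
theorem exists_climb_up {s : ℤ → ℤ} (hs : IsHaggSeq s) (k₀ i₀ j₀ k i j : ℤ) :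
    ∀ n : ℕ, ((3 * (i - i₀) + (haggLabel s (k) - haggLabel s k₀) = 0 ∧ 3 * (j - j₀) + (haggLabel s (k) - haggLabel s k₀) = 0) ∨ (3 * (i - i₀) + (haggLabel s (k) - haggLabel s k₀) = 1 ∧ 3 * (j - j₀) + (haggLabel s (k) - haggLabel s k₀) = 1) ∨ (3 * (i - i₀) + (haggLabel s (k) - haggLabel s k₀) = -1 ∧ 3 * (j - j₀) + (haggLabel s (k) - haggLabel s k₀) = -1) ∨ (3 * (i - i₀) + (haggLabel s (k) - haggLabel s k₀) = -2 ∧ 3 * (j - j₀) + (haggLabel s (k) - haggLabel s k₀) = 1) ∨ (3 * (i - i₀) + (haggLabel s (k) - haggLabel s k₀) = -1 ∧ 3 * (j - j₀) + (haggLabel s (k) - haggLabel s k₀) = 2) ∨ (3 * (i - i₀) + (haggLabel s (k) - haggLabel s k₀) = 1 ∧ 3 * (j - j₀) + (haggLabel s (k) - haggLabel s k₀) = -2) ∨ (3 * (i - i₀) + (haggLabel s (k) - haggLabel s k₀) = 2 ∧ 3 * (j - j₀) + (haggLabel s (k) - haggLabel s k₀) = -1)) →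
      ∃ i' j' : ℤ, ((3 * (i' - i₀) + (haggLabel s (k + n) - haggLabel s k₀) = 0 ∧ 3 * (j' - j₀) + (haggLabel s (k + n) - haggLabel s k₀) = 0) ∨ (3 * (i' - i₀) + (haggLabel s (k + n) - haggLabel s k₀) = 1 ∧ 3 * (j' - j₀) + (haggLabel s (k + n) - haggLabel s k₀) = 1) ∨ (3 * (i' - i₀) + (haggLabel s (k + n) - haggLabel s k₀) = -1 ∧ 3 * (j' - j₀) + (haggLabel s (k + n) - haggLabel s k₀) = -1) ∨ (3 * (i' - i₀) + (haggLabel s (k + n) - haggLabel s k₀) = -2 ∧ 3 * (j' - j₀) + (haggLabel s (k + n) - haggLabel s k₀) = 1) ∨ (3 * (i' - i₀) + (haggLabel s (k + n) - haggLabel s k₀) = -1 ∧ 3 * (j' - j₀) + (haggLabel s (k + n) - haggLabel s k₀) = 2) ∨ (3 * (i' - i₀) + (haggLabel s (k + n) - haggLabel s k₀) = 1 ∧ 3 * (j' - j₀) + (haggLabel s (k + n) - haggLabel s k₀) = -2) ∨ (3 * (i' - i₀) + (haggLabel s (k + n) - haggLabel s k₀) = 2 ∧ 3 * (j' - j₀)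 + (haggLabel s (k + n) - haggLabel s k₀) = -1)) ∧
        ∃ g : ℕ → EuclideanSpace ℝ (Fin 3), g 0 = barlowPos 1 (Real.sqrt (2 / 3)) s k i j ∧ g n = barlowPos 1 (Real.sqrt (2 / 3)) s (k + n) i' j' ∧
          ∀ t : ℕ, t < n → g t ∈ barlowStacking 1 (Real.sqrt (2 / 3)) s ∧ g (t + 1) ∈ barlowStacking 1 (Real.sqrt (2 / 3)) s ∧ dist (g t) (g (t + 1)) = 1 := by
  intro n hE
  induction n with
  | zero =>
    refine ⟨i, j, by simpa using hE, fun _ => barlowPos 1 (Real.sqrt (2 / 3)) s k i j, rfl, by simp, fun t ht => absurd ht (Nat.not_lt_zero _)⟩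
  | succ n ih =>
    obtain ⟨i', j', hE', g, hg0, hgn, hst⟩ := ih
    have hσ : s (k + n) = 1 ∨ s (k + n) = -1 := hs (k + n)
    obtain ⟨P, Q, hPQ, hE''⟩ := climbStep_up hσ hE'
    have hL : haggLabel s (k + ((n + 1 : ℕ) : ℤ)) = haggLabel s (k + n) + s (k + n) := by
      rw [show k + ((n + 1 : ℕ) : ℤ) = k + n + 1 by push_cast; ring]; exact haggLabel_succ s (k + n)
    have e1 : 3 * (i' - P - i₀) + (haggLabel s (k + ((n + 1 : ℕ) : ℤ)) - haggLabel s k₀) =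
        3 * (i' - i₀) + (haggLabel s (k + n) - haggLabel s k₀) - 3 * P + s (k + n) := by rw [hL]; ring
    have e2 : 3 * (j' - Q - j₀) + (haggLabel s (k + ((n + 1 : ℕ) : ℤ)) - haggLabel s k₀) =
        3 * (j' - j₀) + (haggLabel s (k + n) - haggLabel s k₀) - 3 * Q + s (k + n) := by rw [hL]; ring
    have hup := dist_up_eq_one hs (k + n) i' j' hPQ
    have ek : k + (n : ℤ) + 1 = k + ((n + 1 : ℕ) : ℤ) := by push_cast; ring
    rw [ek] at hup
    refine ⟨i' - P, j' - Q, by rw [e1, e2]; exact hE'', fun t => if t ≤ n then g t else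
      barlowPos 1 (Real.sqrt (2 / 3)) s (k + ((n + 1 : ℕ) : ℤ)) (i' - P) (j' - Q), by simp [hg0], by simp, ?_⟩
    intro t ht
    show (if t ≤ n then g t else barlowPos 1 (Real.sqrt (2 / 3)) s (k + ((n + 1 : ℕ) : ℤ)) (i' - P) (j' - Q)) ∈ _ ∧
      (if t + 1 ≤ n then g (t + 1) else barlowPos 1 (Real.sqrt (2 / 3)) s (k + ((n + 1 : ℕ) : ℤ)) (i' - P) (j' - Q)) ∈ _ ∧
      dist (if t ≤ n then g t else barlowPos 1 (Real.sqrt (2 / 3)) s (k + ((n + 1 : ℕ) : ℤ)) (i' - P) (j' - Q))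
        (if t + 1 ≤ n then g (t + 1) else barlowPos 1 (Real.sqrt (2 / 3)) s (k + ((n + 1 : ℕ) : ℤ)) (i' - P) (j' - Q)) = 1
    by_cases htn : t < n
    · rw [if_pos (by omega), if_pos (by omega)]; exact hst t htn
    · have htn' : t = n := by omega
      subst htn'
      rw [if_pos le_rfl, if_neg (by omega), hgn]
      exact ⟨barlowPos_mem _ _ _, hup.1, hup.2⟩

/-- **Climbing `n` layers down with drift control.** [folklore] -/
theorem exists_climb_down {s : ℤ → ℤ} (hs : IsHaggSeq s) (k₀ i₀ j₀ k i j : ℤ) :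
    ∀ n : ℕ, ((3 * (i - i₀) + (haggLabel s (k) - haggLabel s k₀) = 0 ∧ 3 * (j - j₀) + (haggLabel s (k) - haggLabel s k₀) = 0) ∨ (3 * (i - i₀) + (haggLabel s (k) - haggLabel s k₀) = 1 ∧ 3 * (j - j₀) + (haggLabel s (k) - haggLabel s k₀) = 1) ∨ (3 * (i - i₀) + (haggLabel s (k) - haggLabel s k₀) = -1 ∧ 3 * (j - j₀) + (haggLabel s (k) - haggLabel s k₀) = -1) ∨ (3 * (i - i₀) + (haggLabel s (k) - haggLabel s k₀) = -2 ∧ 3 * (j - j₀) + (haggLabel s (k) - haggLabel s k₀) = 1) ∨ (3 * (i - i₀) + (haggLabel s (k) - haggLabel s k₀) = -1 ∧ 3 * (j - j₀) + (haggLabel s (k) - haggLabel s k₀) = 2) ∨ (3 * (i - i₀) + (haggLabel s (k) - haggLabel s k₀) = 1 ∧ 3 * (j - j₀) + (haggLabel s (k) - haggLabel s k₀) = -2) ∨ (3 * (i - i₀) + (haggLabel s (k) - haggLabel s k₀) = 2 ∧ 3 * (j - j₀) + (haggLabel s (k) - haggLabel s k₀) = -1)) →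
      ∃ i' j' : ℤ, ((3 * (i' - i₀) + (haggLabel s (k - n) - haggLabel s k₀) = 0 ∧ 3 * (j' - j₀) + (haggLabel s (k - n) - haggLabel s k₀) = 0) ∨ (3 * (i' - i₀) + (haggLabel s (k - n) - haggLabel s k₀) = 1 ∧ 3 * (j' - j₀) + (haggLabel s (k - n) - haggLabel s k₀) = 1) ∨ (3 * (i' - i₀) + (haggLabel s (k - n) - haggLabel s k₀) = -1 ∧ 3 * (j' - j₀) + (haggLabel s (k - n) - haggLabel s k₀) = -1) ∨ (3 * (i' - i₀) + (haggLabel s (k - n) - haggLabel s k₀) = -2 ∧ 3 * (j' - j₀) + (haggLabel s (k - n) - haggLabel s k₀) = 1) ∨ (3 * (i' - i₀) + (haggLabel s (k - n) - haggLabel s k₀) = -1 ∧ 3 * (j' - j₀) + (haggLabel s (k - n) - haggLabel s k₀) = 2) ∨ (3 * (i' - i₀) + (haggLabel s (k - n) - haggLabel s k₀) = 1 ∧ 3 * (j' - j₀) + (haggLabel s (k - n) - haggLabel s k₀) = -2) ∨ (3 * (i' - i₀) + (haggLabel s (k - n) - haggLabel s k₀) = 2 ∧ 3 * (j' - j₀)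 + (haggLabel s (k - n) - haggLabel s k₀) = -1)) ∧
        ∃ g : ℕ → EuclideanSpace ℝ (Fin 3), g 0 = barlowPos 1 (Real.sqrt (2 / 3)) s k i j ∧ g n = barlowPos 1 (Real.sqrt (2 / 3)) s (k - n) i' j' ∧
          ∀ t : ℕ, t < n → g t ∈ barlowStacking 1 (Real.sqrt (2 / 3)) s ∧ g (t + 1) ∈ barlowStacking 1 (Real.sqrt (2 / 3)) s ∧ dist (g t) (g (t + 1)) = 1 := by
  intro n hE
  induction n with
  | zero =>
    refine ⟨i, j, by simpa using hE, fun _ => barlowPos 1 (Real.sqrt (2 / 3)) s k i j, rfl, by simp, fun t ht => absurd ht (Nat.not_lt_zero _)⟩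
  | succ n ih =>
    obtain ⟨i', j', hE', g, hg0, hgn, hst⟩ := ih
    have hσ : s (k - n - 1) = 1 ∨ s (k - n - 1) = -1 := hs (k - n - 1)
    obtain ⟨P, Q, hPQ, hE''⟩ := climbStep_down hσ hE'
    have hL : haggLabel s (k - ((n + 1 : ℕ) : ℤ)) = haggLabel s (k - n) - s (k - n - 1) := by
      have := haggLabel_succ s (k - n - 1)
      rw [sub_add_cancel] at this
      rw [show k - ((n + 1 : ℕ) : ℤ) = k - n - 1 by push_cast; ring, this]; ring
    have e1 : 3 * (i' - P - i₀) + (haggLabel s (k - ((n + 1 : ℕ) : ℤ)) - haggLabel s k₀) =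
        3 * (i' - i₀) + (haggLabel s (k - n) - haggLabel s k₀) - 3 * P - s (k - n - 1) := by rw [hL]; ring
    have e2 : 3 * (j' - Q - j₀) + (haggLabel s (k - ((n + 1 : ℕ) : ℤ)) - haggLabel s k₀) =
        3 * (j' - j₀) + (haggLabel s (k - n) - haggLabel s k₀) - 3 * Q - s (k - n - 1) := by rw [hL]; ring
    have hdown := dist_down_eq_one hs (k - n) i' j' hPQ
    have ek : k - (n : ℤ) + (-1) = k - ((n + 1 : ℕ) : ℤ) := by push_cast; ring
    rw [ek] at hdown
    refine ⟨i' - P, j' - Q, by rw [e1, e2]; exact hE'', fun t => if t ≤ n then g t else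
      barlowPos 1 (Real.sqrt (2 / 3)) s (k - ((n + 1 : ℕ) : ℤ)) (i' - P) (j' - Q), by simp [hg0], by simp, ?_⟩
    intro t ht
    show (if t ≤ n then g t else barlowPos 1 (Real.sqrt (2 / 3)) s (k - ((n + 1 : ℕ) : ℤ)) (i' - P) (j' - Q)) ∈ _ ∧
      (if t + 1 ≤ n then g (t + 1) else barlowPos 1 (Real.sqrt (2 / 3)) s (k - ((n + 1 : ℕ) : ℤ)) (i' - P) (j' - Q)) ∈ _ ∧
      dist (if t ≤ n then g t else barlowPos 1 (Real.sqrt (2 / 3)) s (k - ((n + 1 : ℕ) : ℤ)) (i' - P) (j' - Q))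
        (if t + 1 ≤ n then g (t + 1) else barlowPos 1 (Real.sqrt (2 / 3)) s (k - ((n + 1 : ℕ) : ℤ)) (i' - P) (j' - Q)) = 1
    by_cases htn : t < n
    · rw [if_pos (by omega), if_pos (by omega)]; exact hst t htn
    · have htn' : t = n := by omega
      subst htn'
      rw [if_pos le_rfl, if_neg (by omega), hgn]
      exact ⟨barlowPos_mem _ _ _, hdown.1, hdown.2⟩

/-! ## Walking in a layer -/

/-- **In-layer walks**: `(k, i, j)` and `(k, i', j')` are joined inside layer `k` by a contact walk
of length `≤ h` whenever `|i' − i| + |j' − j| + |(i' − i) + (j' − j)| ≤ 2h` (the left side is twice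
the hexagonal graph distance). [folklore] -/
theorem exists_planeWalk {s : ℤ → ℤ} (hs : IsHaggSeq s) (k : ℤ) :
    ∀ (h : ℕ) (i j i' j' : ℤ), (i' - i).natAbs + (j' - j).natAbs + (i' - i + (j' - j)).natAbs ≤ 2 * h →
      ∃ l : ℕ, l ≤ h ∧ ∃ g : ℕ → EuclideanSpace ℝ (Fin 3), g 0 = barlowPos 1 (Real.sqrt (2 / 3)) s k i j ∧ g l = barlowPos 1 (Real.sqrt (2 / 3)) s k i' j' ∧
        ∀ t : ℕ, t < l → g t ∈ barlowStacking 1 (Real.sqrt (2 / 3)) s ∧ g (t + 1) ∈ barlowStacking 1 (Real.sqrt (2 / 3)) s ∧ dist (g t) (g (t + 1)) = 1 := by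
  intro h
  induction h with
  | zero =>
    intro i j i' j' hh
    have hi : i' = i := by omega
    have hj : j' = j := by omega
    subst hi hj
    exact ⟨0, le_rfl, fun _ => barlowPos 1 (Real.sqrt (2 / 3)) s k i' j', rfl, rfl, fun t ht => absurd ht (Nat.not_lt_zero _)⟩
  | succ h ih =>
    intro i j i' j' hh
    by_cases h0 : i' = i ∧ j' = j
    · obtain ⟨rfl, rfl⟩ := h0
      exact ⟨0, by omega, fun _ => barlowPos 1 (Real.sqrt (2 / 3)) s k i' j', rfl, rfl, fun t ht => absurd ht (Nat.not_lt_zero _)⟩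
    · -- one step of `sixOffsets` lowering the hexagonal distance
      obtain ⟨P, Q, hPQ, hh'⟩ : ∃ P Q : ℤ, (P, Q) ∈ sixOffsets ∧
          (i' - (i - P)).natAbs + (j' - (j - Q)).natAbs + (i' - (i - P) + (j' - (j - Q))).natAbs ≤ 2 * h := by
        rcases lt_trichotomy i' i with hi | hi | hi <;> rcases lt_trichotomy j' j with hj | hj | hj
        · exact ⟨1, 0, by decide, by omega⟩
        · exact ⟨1, 0, by decide, by omega⟩
        · exact ⟨1, -1, by decide, by omega⟩
        · exact ⟨0, 1, by decide, by omega⟩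
        · exact absurd ⟨hi, hj⟩ h0
        · exact ⟨0, -1, by decide, by omega⟩
        · exact ⟨-1, 1, by decide, by omega⟩
        · exact ⟨-1, 0, by decide, by omega⟩
        · exact ⟨-1, 0, by decide, by omega⟩
      obtain ⟨l, hl, g, hg0, hgl, hst⟩ := ih (i - P) (j - Q) i' j' hh'
      have hsix := dist_six_eq_one hs k i j hPQ
      rw [add_zero] at hsix
      refine ⟨l + 1, by omega, fun t => if t = 0 then barlowPos 1 (Real.sqrt (2 / 3)) s k i j else g (t - 1), by simp, ?_, ?_⟩
      · show (if l + 1 = 0 then barlowPos 1 (Real.sqrt (2 / 3)) s k i j else g (l + 1 - 1)) = _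
        rw [if_neg (by omega), show l + 1 - 1 = l by omega, hgl]
      · intro t ht
        show (if t = 0 then barlowPos 1 (Real.sqrt (2 / 3)) s k i j else g (t - 1)) ∈ _ ∧
          (if t + 1 = 0 then barlowPos 1 (Real.sqrt (2 / 3)) s k i j else g (t + 1 - 1)) ∈ _ ∧
          dist (if t = 0 then barlowPos 1 (Real.sqrt (2 / 3)) s k i j else g (t - 1)) (if t + 1 = 0 then barlowPos 1 (Real.sqrt (2 / 3)) s k i j else g (t + 1 - 1)) = 1
        by_cases ht0 : t = 0
        · subst ht0
          rw [if_pos rfl, if_neg (by omega), show 0 + 1 - 1 = 0 by rfl, hg0]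
          exact ⟨barlowPos_mem _ _ _, hsix.1, hsix.2⟩
        · rw [if_neg ht0, if_neg (by omega), show t + 1 - 1 = t - 1 + 1 by omega]
          exact hst (t - 1) (by omega)


/-! ## Length estimates -/

/-- Twice the hexagonal norm is at most `4/√3` times the Euclidean norm:
`3 (|a| + |b| + |a + b|)² ≤ 16 (a² + ab + b²)`. [folklore] -/
theorem hexNorm_sq_le (a b : ℤ) : 3 * (|a| + |b| + |a + b|) ^ 2 ≤ 16 * (a ^ 2 + a * b + b ^ 2) := by
  rcases le_total 0 a with ha | ha <;> rcases le_total 0 b with hb | hb <;>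
  rcases le_total 0 (a + b) with hab | hab <;>
  simp only [abs_of_nonneg, abs_of_nonpos, ha, hb, hab] <;>
  nlinarith [sq_nonneg (a - b), sq_nonneg (a + 2 * b), sq_nonneg (2 * a + b)]

/-- The drift states of `S₇` have weighted norm `(E₁² + E₁E₂ + E₂²)/9 ≤ 1/3`. [folklore] -/
theorem drift_sq_le {E₁ E₂ : ℤ}
    (hE : ((E₁ = 0 ∧ E₂ = 0) ∨ (E₁ = 1 ∧ E₂ = 1) ∨ (E₁ = -1 ∧ E₂ = -1) ∨ (E₁ = -2 ∧ E₂ = 1) ∨ (E₁ = -1 ∧ E₂ = 2) ∨ (E₁ = 1 ∧ E₂ = -2) ∨ (E₁ = 2 ∧ E₂ = -1))) :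
    ((2 * (E₁ : ℝ) + E₂) / 6) ^ 2 + 3 / 4 * ((E₂ : ℝ) / 3) ^ 2 ≤ 1 / 3 := by
  rcases hE with ⟨rfl, rfl⟩ | ⟨rfl, rfl⟩ | ⟨rfl, rfl⟩ | ⟨rfl, rfl⟩ | ⟨rfl, rfl⟩ | ⟨rfl, rfl⟩ | ⟨rfl, rfl⟩ <;>
  norm_num

/-- Cauchy–Schwarz for the weighted form `x₁y₁ + (3/4) x₂y₂`. [folklore] -/
theorem weighted_cs (X Y e f : ℝ) :
    (X * e + 3 / 4 * Y * f) ^ 2 ≤ (X ^ 2 + 3 / 4 * Y ^ 2) * (e ^ 2 + 3 / 4 * f ^ 2) := by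
  nlinarith [sq_nonneg (X * f - Y * e)]

/-- The quadratic-form step of the length estimate: `n + (231/200) ρ ≤ (17/10) d` when
`d² = ρ² + (2/3) n²`. [folklore] -/
theorem climb_plus_plane_le {n ρ d : ℝ} (hn : 0 ≤ n) (hρ : 0 ≤ ρ) (hd : 0 ≤ d)
    (h : d ^ 2 = ρ ^ 2 + 2 / 3 * n ^ 2) : n + 231 / 200 * ρ ≤ 17 / 10 * d := by
  have h1 : (n + 231 / 200 * ρ) ^ 2 ≤ (17 / 10 * d) ^ 2 := by nlinarith [sq_nonneg (n - 5 / 4 * ρ)]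
  exact (pow_le_pow_iff_left₀ (by positivity) (by positivity) two_ne_zero).1 h1



/-- **The length estimate** (pure real arithmetic).  With `d² = X² + (3/4)Y² + (2/3)n²`, an
in-layer offset `(a, b)` with `a + b/2 = X − e`, `b = Y − f`, drift `e² + (3/4)f² ≤ 1/3` and
hexagonal count `3 num² ≤ 16 (a² + ab + b²)`: `n + (num + 1)/2 ≤ (17/10) d + 2`
(Cauchy–Schwarz gives `a² + ab + b² ≤ (ρ + 1/√3)²`, `ρ² = X² + (3/4)Y²`, and
`n + (231/200) ρ ≤ (17/10) d`). [folklore] -/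
theorem walkLength_real {X Y e f a b n num d : ℝ} (hn : 0 ≤ n) (hnum0 : 0 ≤ num) (hd0 : 0 ≤ d)
    (hdrift : e ^ 2 + 3 / 4 * f ^ 2 ≤ 1 / 3) (ha : a + b / 2 = X - e) (hb : b = Y - f)
    (hhex : 3 * num ^ 2 ≤ 16 * (a ^ 2 + a * b + b ^ 2))
    (hd2 : d ^ 2 = X ^ 2 + 3 / 4 * Y ^ 2 + 2 / 3 * n ^ 2) :
    n + (num + 1) / 2 ≤ 17 / 10 * d + 2 := by
  have hN2 : a ^ 2 + a * b + b ^ 2 = (X - e) ^ 2 + 3 / 4 * (Y - f) ^ 2 := by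
    have : a = X - e - b / 2 := by linarith
    rw [this, hb]; ring
  obtain ⟨ρ, hρ⟩ : ∃ ρ : ℝ, ρ = Real.sqrt (X ^ 2 + 3 / 4 * Y ^ 2) := ⟨_, rfl⟩
  have hρ0 : 0 ≤ ρ := by rw [hρ]; exact Real.sqrt_nonneg _
  have hρ2 : ρ ^ 2 = X ^ 2 + 3 / 4 * Y ^ 2 := by rw [hρ]; exact Real.sq_sqrt (by positivity)
  obtain ⟨τ, hτ⟩ : ∃ τ : ℝ, τ = Real.sqrt (e ^ 2 + 3 / 4 * f ^ 2) := ⟨_, rfl⟩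
  have hτ0 : 0 ≤ τ := by rw [hτ]; exact Real.sqrt_nonneg _
  have hτ2 : τ ^ 2 = e ^ 2 + 3 / 4 * f ^ 2 := by rw [hτ]; exact Real.sq_sqrt (by positivity)
  have hτle : τ ≤ 5774 / 10000 := by rw [hτ, Real.sqrt_le_left (by norm_num)]; linarith
  have hcs := weighted_cs X Y e f
  have hcs' : -(X * e + 3 / 4 * Y * f) ≤ ρ * τ := by
    have h1 : (X * e + 3 / 4 * Y * f) ^ 2 ≤ (ρ * τ) ^ 2 := by rw [mul_pow, hρ2, hτ2]; exact hcs
    have := abs_le_of_sq_le_sq h1 (by positivity)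
    rw [abs_le] at this; linarith [this.1]
  have hN2' : a ^ 2 + a * b + b ^ 2 ≤ (ρ + τ) ^ 2 := by
    rw [hN2]
    have e1 : (X - e) ^ 2 + 3 / 4 * (Y - f) ^ 2 =
        (X ^ 2 + 3 / 4 * Y ^ 2) - 2 * (X * e + 3 / 4 * Y * f) + (e ^ 2 + 3 / 4 * f ^ 2) := by ring
    rw [e1, ← hρ2, ← hτ2]; nlinarith
  have hnum_le : num ≤ 231 / 100 * (ρ + τ) := by
    have h0 : 0 ≤ ρ + τ := by positivity
    have h1 : num ^ 2 ≤ (231 / 100 * (ρ + τ)) ^ 2 :=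
      calc num ^ 2 ≤ 16 / 3 * (a ^ 2 + a * b + b ^ 2) := by linarith
        _ ≤ 16 / 3 * (ρ + τ) ^ 2 := by linarith [hN2']
        _ ≤ (231 / 100 * (ρ + τ)) ^ 2 := by nlinarith [sq_nonneg (ρ + τ)]
    exact (pow_le_pow_iff_left₀ hnum0 (by positivity) two_ne_zero).1 h1
  have hquad := climb_plus_plane_le hn hρ0 hd0 (by rw [hd2, hρ2])
  linarith

/-- **Contact walks in the model** (anchor of this file): two points of the stacking at distance
`≤ r` are joined by a walk of unit contacts of length `≤ (17/10) r + 2`. [folklore] -/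
theorem exists_modelWalk :
    ∀ (s : ℤ → ℤ) (k i j k' i' j' : ℤ) (r : ℝ), IsHaggSeq s → dist (barlowPos 1 (Real.sqrt (2
    / 3)) s k i j) (barlowPos 1 (Real.sqrt (2 / 3)) s k' i' j') ≤ r → ∃ l : ℕ, (l : ℝ) ≤ 17 / 10
    * r + 2 ∧ ∃ g : ℕ → EuclideanSpace ℝ (Fin 3), g 0 = barlowPos 1 (Real.sqrt (2 / 3)) s k i j ∧
    g l = barlowPos 1 (Real.sqrt (2 / 3)) s k' i' j' ∧ ∀ t : ℕ, t < l → g t ∈ barlowStacking 1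
    (Real.sqrt (2 / 3)) s ∧ g (t + 1) ∈ barlowStacking 1 (Real.sqrt (2 / 3)) s ∧ dist (g t) (g (t
    + 1)) = 1 := by
  intro s k i j k' i' j' r hs hd
  -- Phase 1: climb to layer `k'`
  set n : ℕ := (k' - k).natAbs with hn_def
  obtain ⟨i₁, j₁, hE, g₁, hg₁0, hg₁n, hst₁⟩ :
      ∃ i₁ j₁ : ℤ, ((3 * (i₁ - i) + (haggLabel s k' - haggLabel s k) = 0 ∧ 3 * (j₁ - j) + (haggLabel s k' - haggLabel s k) = 0) ∨
        (3 * (i₁ - i) + (haggLabel s k' - haggLabel s k) = 1 ∧ 3 * (j₁ - j) + (haggLabel s k' - haggLabel s k) = 1) ∨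
        (3 * (i₁ - i) + (haggLabel s k' - haggLabel s k) = -1 ∧ 3 * (j₁ - j) + (haggLabel s k' - haggLabel s k) = -1) ∨
        (3 * (i₁ - i) + (haggLabel s k' - haggLabel s k) = -2 ∧ 3 * (j₁ - j) + (haggLabel s k' - haggLabel s k) = 1) ∨
        (3 * (i₁ - i) + (haggLabel s k' - haggLabel s k) = -1 ∧ 3 * (j₁ - j) + (haggLabel s k' - haggLabel s k) = 2) ∨
        (3 * (i₁ - i) + (haggLabel s k' - haggLabel s k) = 1 ∧ 3 * (j₁ - j) + (haggLabel s k' - haggLabel s k) = -2) ∨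
        (3 * (i₁ - i) + (haggLabel s k' - haggLabel s k) = 2 ∧ 3 * (j₁ - j) + (haggLabel s k' - haggLabel s k) = -1)) ∧
      ∃ g : ℕ → EuclideanSpace ℝ (Fin 3), g 0 = barlowPos 1 (Real.sqrt (2 / 3)) s k i j ∧
        g n = barlowPos 1 (Real.sqrt (2 / 3)) s k' i₁ j₁ ∧
        ∀ t : ℕ, t < n → g t ∈ barlowStacking 1 (Real.sqrt (2 / 3)) s ∧
          g (t + 1) ∈ barlowStacking 1 (Real.sqrt (2 / 3)) s ∧ dist (g t) (g (t + 1)) = 1 := by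
    rcases le_total k k' with hkk | hkk
    · have ek : k + (n : ℤ) = k' := by omega
      have := exists_climb_up hs k i j k i j n (Or.inl ⟨by ring, by ring⟩)
      rw [ek] at this
      exact this
    · have ek : k - (n : ℤ) = k' := by omega
      have := exists_climb_down hs k i j k i j n (Or.inl ⟨by ring, by ring⟩)
      rw [ek] at this
      exact this
  -- Phase 2: walk inside layer `k'`
  set num : ℕ := (i' - i₁).natAbs + (j' - j₁).natAbs + (i' - i₁ + (j' - j₁)).natAbs with hnum
  obtain ⟨l₂, hl₂, g₂, hg₂0, hg₂l, hst₂⟩ :=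
    exists_planeWalk hs k' ((num + 1) / 2) i₁ j₁ i' j' (by omega)
  -- concatenation
  refine ⟨n + l₂, ?_, fun t => if t ≤ n then g₁ t else g₂ (t - n), by simp [hg₁0], ?_, ?_⟩
  rotate_left
  · show (if n + l₂ ≤ n then g₁ (n + l₂) else g₂ (n + l₂ - n)) = _
    by_cases hl0 : l₂ = 0
    · subst hl0
      rw [if_pos (by omega), add_zero, hg₁n, ← hg₂0]; exact hg₂l
    · rw [if_neg (by omega), show n + l₂ - n = l₂ by omega, hg₂l]
  · intro t ht
    show (if t ≤ n then g₁ t else g₂ (t - n)) ∈ _ ∧ (if t + 1 ≤ n then g₁ (t + 1) else g₂ (t + 1 - n)) ∈ _ ∧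
      dist (if t ≤ n then g₁ t else g₂ (t - n)) (if t + 1 ≤ n then g₁ (t + 1) else g₂ (t + 1 - n)) = 1
    by_cases htn : t < n
    · rw [if_pos (by omega), if_pos (by omega)]; exact hst₁ t htn
    · by_cases hte : t = n
      · rw [hte, if_pos le_rfl, if_neg (by omega), hg₁n, ← hg₂0, show n + 1 - n = 0 + 1 by omega]
        exact hst₂ 0 (by omega)
      · rw [if_neg (by omega), if_neg (by omega), show t + 1 - n = t - n + 1 by omega]
        exact hst₂ (t - n) (by omega)
  · -- the length estimate
    have hsq := dist_barlowPos_sq 1 (Real.sqrt (2 / 3)) s k i j k' i' j'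
    have h23 : Real.sqrt (2 / 3) ^ 2 = 2 / 3 := Real.sq_sqrt (by norm_num)
    have h3 : Real.sqrt 3 ^ 2 = 3 := Real.sq_sqrt (by norm_num)
    have en : ((n : ℤ) : ℝ) = |(k' : ℝ) - k| := by
      rw [hn_def, Int.natCast_natAbs, Int.cast_abs, Int.cast_sub]
    have hd2 : dist (barlowPos 1 (Real.sqrt (2 / 3)) s k i j) (barlowPos 1 (Real.sqrt (2 / 3)) s k' i' j') ^ 2 =
        (((i' : ℝ) - i) + ((j' : ℝ) - j) / 2 + ((haggLabel s k' : ℝ) - haggLabel s k) / 2) ^ 2 +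
        3 / 4 * (((j' : ℝ) - j) + ((haggLabel s k' : ℝ) - haggLabel s k) / 3) ^ 2 + 2 / 3 * ((n : ℝ)) ^ 2 := by
      have en2 : ((n : ℝ)) ^ 2 = ((k : ℝ) - k') ^ 2 := by
        rw [show ((n : ℝ)) = ((n : ℤ) : ℝ) by norm_cast, en, sq_abs]; ring
      rw [hsq, en2, mul_pow (((k : ℝ) - k')), h23, one_mul, mul_pow, div_pow, mul_pow, h3]; ring
    have hdrift := drift_sq_le hE
    have hhex : 3 * ((num : ℝ)) ^ 2 ≤ 16 * ((((i' - i₁ : ℤ) : ℝ)) ^ 2 + ((i' - i₁ : ℤ) : ℝ) * ((j' - j₁ : ℤ) : ℝ) +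
        (((j' - j₁ : ℤ) : ℝ)) ^ 2) := by
      have hnumR : ((num : ℝ)) = |((i' - i₁ : ℤ) : ℝ)| + |((j' - j₁ : ℤ) : ℝ)| + |((i' - i₁ : ℤ) : ℝ) + ((j' - j₁ : ℤ) : ℝ)| := by
        rw [hnum]; push_cast [Nat.cast_natAbs, Int.cast_abs]; ring_nf
      rw [hnumR]; exact_mod_cast hexNorm_sq_le (i' - i₁) (j' - j₁)
    have hl₂R : (l₂ : ℝ) ≤ ((num : ℝ) + 1) / 2 := by
      have h1 : (l₂ : ℝ) ≤ (((num + 1) / 2 : ℕ) : ℝ) := by exact_mod_cast hl₂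
      refine h1.trans ?_
      have h2 := Nat.cast_div_le (m := num + 1) (n := 2) (α := ℝ)
      push_cast at h2 ⊢; linarith
    have key := walkLength_real (Nat.cast_nonneg n) (Nat.cast_nonneg num) dist_nonneg hdrift
      (X := ((i' : ℝ) - i) + ((j' : ℝ) - j) / 2 + ((haggLabel s k' : ℝ) - haggLabel s k) / 2)
      (Y := ((j' : ℝ) - j) + ((haggLabel s k' : ℝ) - haggLabel s k) / 3)
      (a := ((i' - i₁ : ℤ) : ℝ)) (b := ((j' - j₁ : ℤ) : ℝ)) (by push_cast; ring) (by push_cast; ring) hhex hd2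
    push_cast
    linarith [key, hl₂R, hd]

end Summit.AtomisticToContinuum.Crystallization.Theorems.SquareWellLayerCakeGapTwelveToBarlow
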